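import Mathlib
import HarnessLib

/-!
# One-step integrators: uniform consistency plus Lipschitz stability of the exact flow gives convergence (the Lax principle, with the global error bound)

HONEST FRAMING: exact (Metropolis-corrected) sampling algorithms for lattice gauge theory;
figures of merit are autocorrelation/cost numbers at stated couplings and volumes; no
continuum-physics claim.

Venture `LatticeQCDFlow` (cell pub-lqcd), sub-topic `Scoring`; FANOUT row 16 (`su2-base`: the 4-d `SU(2)`
baselines measure the clover charge `Q` and the clover energy `t²E` on the field flowed by `m = t/ε` steps of
the engine's RK3 integrator `Scoring/WilsonFlowRK3.wilsonFlowRK3 ε`, not by the exact flow `wilsonFlow t`).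
NEW WORK of the cell (placement rule): the ABSTRACT half of the convergence theorem for the engine's
integrator (sequel `Scoring/WilsonFlowRK3Convergence`); elementary real analysis over Mathlib, nothing is
cited as a fact, no number.  Printed counterpart, NAMED ONLY: the convergence theorem for one-step methods
(Hairer–Nørsett–Wanner, *Solving ODEs I*, §II.3, Thm. 3.4 / 3.6: "consistency of order `p` + Lipschitz
stability ⇒ convergence of order `p`"; Lax's principle).  `Scoring/WilsonFlowRK3Consistency` and row 7's
`Exactness/SphereGradientFlowEulerStep` prove first-order CONSISTENCY of their integrators and both list the
global error as NOT CLAIMED; this file is the missing bridge, once, for any state space.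

## Setting (a pseudo-metric space `X`; everything restricted to a set `K ⊆ X`)

* `φ : ℝ → X → X` — the EXACT flow: `φ 0 = id` and `φ (s + t) = φ s ∘ φ t` on `K`, `K` invariant, and
  LIPSCHITZ STABLE on `K`: `dist (φ s x) (φ s y) ≤ e^{L s} dist x y` for `s ≥ 0`, `x, y ∈ K` (`L ≥ 0`; for an
  ODE with an `L`-Lipschitz vector field on `K` this is Grönwall, Mathlib's `dist_le_of_trajectories_ODE_of_mem`);
* `Φ : ℝ → X → X` — the NUMERICAL one-step map (`Φ ε` = one step of size `ε`), `K` invariant;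
* CONSISTENCY at level `η` for the step `ε`: `dist (Φ ε x) (φ ε x) ≤ η ε` for all `x ∈ K`.

## What is proved

* `discreteGronwall_le` — the discrete Grönwall recursion: `e₀ ≤ 0`, `e_{k+1} ≤ a + b e_k`, `a ≥ 0`, `b ≥ 1` give
  `e_k ≤ k a bᵏ`.
* **`oneStep_dist_iterate_le`** — the GLOBAL ERROR BOUND after `k` steps of size `ε ≥ 0`:
  `dist ((Φ ε)^[k] x) (φ (k ε) x) ≤ k (η ε) e^{L k ε}` for every `x ∈ K` (local errors are injected at rate
  `η ε` per step and amplified by at most `e^{L ε}` per step by the exact flow).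
* **`oneStep_dist_iterate_le_of_order`** — consistency of ORDER `p + 1` (`dist (Φ ε x) (φ ε x) ≤ C ε^{p+1}` on `K`)
  gives convergence of order `p` at fixed time `T = k ε`: global error `≤ C T e^{L T} εᵖ`.
* **`oneStep_tendstoUniformlyOn_iterate`** — if the consistency is UNIFORM on `K` (`∀ η > 0`, for all small `ε > 0`,
  `sup_{x ∈ K} dist (Φ ε x) (φ ε x) ≤ η ε`), then for every `t > 0` the `m`-step approximations with step `t/m`
  converge to the exact flow UNIFORMLY on `K`: `(Φ (t/m))^[m] → φ t` as `m → ∞`;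
  `oneStep_tendsto_iterate` — pointwise form at each `x ∈ K`.

NOT CLAIMED: anything about a particular integrator (the instances are the sequels), variable step sizes,
stiff problems / implicit methods, round-off; any number.
-/

namespace Summit.Ventures.LatticeQCDFlow.Scoring

open Filter Topology Set

/-! ## §1 The discrete Grönwall recursion -/

/-- **Discrete Grönwall recursion.**  If `e₀ ≤ 0`, `e_{k+1} ≤ a + b · e_k` with `a ≥ 0` and `b ≥ 1`, then
`e_k ≤ k · a · bᵏ` for every `k`. -/
theorem discreteGronwall_le {e : ℕ → ℝ} {a b : ℝ} (ha : 0 ≤ a) (hb : 1 ≤ b) (h0 : e 0 ≤ 0)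
    (hrec : ∀ k, e (k + 1) ≤ a + b * e k) (k : ℕ) : e k ≤ k * a * b ^ k := by
  induction k with
  | zero => simpa using h0
  | succ k ih =>
    have hb0 : 0 ≤ b := le_trans zero_le_one hb
    have hbk1 : 1 ≤ b ^ (k + 1) := one_le_pow₀ hb
    calc e (k + 1) ≤ a + b * e k := hrec k
      _ ≤ a + b * (k * a * b ^ k) := by gcongr
      _ = a + k * a * b ^ (k + 1) := by ring
      _ ≤ a * b ^ (k + 1) + k * a * b ^ (k + 1) := by
          gcongr
          exact le_mul_of_one_le_right ha hbk1
      _ = ((k + 1 : ℕ) : ℝ) * a * b ^ (k + 1) := by push_cast; ring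

/-! ## §2 The global error bound -/

section Global

variable {X : Type*} [PseudoMetricSpace X]

/-- **Global error of a one-step method** (Lax: stability + consistency).  Let `K` be invariant under the
exact flow `φ` and the one-step map `Φ ε` (`ε ≥ 0`); let `φ` be a flow on `K` (`φ 0 = id`,
`φ (s + t) = φ s ∘ φ t`) that is Lipschitz stable on `K` with rate `L ≥ 0`, and let the one-step map be
consistent at level `η` for the step `ε` on `K`.  Then after `k` steps
`dist ((Φ ε)^[k] x) (φ (k ε) x) ≤ k · (η ε) · e^{L k ε}` for every `x ∈ K`. -/
theorem oneStep_dist_iterate_le {K : Set X} {φ Φ : ℝ → X → X} {L η ε : ℝ} (hL : 0 ≤ L) (hε : 0 ≤ ε)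
    (hφK : ∀ s, 0 ≤ s → MapsTo (φ s) K K) (hΦK : MapsTo (Φ ε) K K)
    (hφ0 : ∀ x ∈ K, φ 0 x = x) (hφadd : ∀ s t, 0 ≤ s → 0 ≤ t → ∀ x ∈ K, φ (s + t) x = φ s (φ t x))
    (hLip : ∀ s, 0 ≤ s → ∀ x ∈ K, ∀ y ∈ K, dist (φ s x) (φ s y) ≤ Real.exp (L * s) * dist x y)
    (hcons : ∀ x ∈ K, dist (Φ ε x) (φ ε x) ≤ η * ε) (x : X) (hx : x ∈ K) (k : ℕ) :
    dist ((Φ ε)^[k] x) (φ (k * ε) x) ≤ k * (η * ε) * Real.exp (L * (k * ε)) := by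
  -- the error sequence and its recursion
  set e : ℕ → ℝ := fun k => dist ((Φ ε)^[k] x) (φ (k * ε) x) with he
  have hηε : 0 ≤ η * ε := by
    have h := hcons x hx
    exact le_trans dist_nonneg h
  have hb : 1 ≤ Real.exp (L * ε) := Real.one_le_exp (mul_nonneg hL hε)
  have h0 : e 0 ≤ 0 := by
    simp only [he, Function.iterate_zero, id_eq, Nat.cast_zero, zero_mul, hφ0 x hx, dist_self, le_refl]
  have hrec : ∀ k, e (k + 1) ≤ η * ε + Real.exp (L * ε) * e k := by
    intro k
    have hyK : (Φ ε)^[k] x ∈ K := hΦK.iterate k hx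
    have hzK : φ (k * ε) x ∈ K := hφK _ (mul_nonneg (Nat.cast_nonneg k) hε) hx
    have hstep : (Φ ε)^[k + 1] x = Φ ε ((Φ ε)^[k] x) := Function.iterate_succ_apply' _ _ _
    have hflow : φ (((k + 1 : ℕ) : ℝ) * ε) x = φ ε (φ (k * ε) x) := by
      rw [Nat.cast_succ, add_mul, one_mul, add_comm]
      exact hφadd ε (k * ε) hε (mul_nonneg (Nat.cast_nonneg k) hε) x hx
    calc e (k + 1) = dist (Φ ε ((Φ ε)^[k] x)) (φ ε (φ (k * ε) x)) := by
            simp only [he, hstep, hflow]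
      _ ≤ dist (Φ ε ((Φ ε)^[k] x)) (φ ε ((Φ ε)^[k] x)) + dist (φ ε ((Φ ε)^[k] x)) (φ ε (φ (k * ε) x)) :=
            dist_triangle _ _ _
      _ ≤ η * ε + Real.exp (L * ε) * e k := add_le_add (hcons _ hyK) (hLip ε hε _ hyK _ hzK)
  have hmain := discreteGronwall_le hηε hb h0 hrec k
  -- `(e^{Lε})^k = e^{L k ε}`
  have hpow : Real.exp (L * ε) ^ k = Real.exp (L * (k * ε)) := by
    rw [← Real.exp_nat_mul]; ring_nf
  simpa only [he, hpow] using hmain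

/-- **Consistency of order `p + 1` gives convergence of order `p`.**  If on `K` the local error is
`dist (Φ ε x) (φ ε x) ≤ C ε^{p+1}`, then at the fixed time `T = k ε` the global error is at most
`C · T · e^{L T} · εᵖ`. -/
theorem oneStep_dist_iterate_le_of_order {K : Set X} {φ Φ : ℝ → X → X} {L C ε : ℝ} {p : ℕ} (hL : 0 ≤ L) (hε : 0 ≤ ε)
    (hφK : ∀ s, 0 ≤ s → MapsTo (φ s) K K) (hΦK : MapsTo (Φ ε) K K)
    (hφ0 : ∀ x ∈ K, φ 0 x = x) (hφadd : ∀ s t, 0 ≤ s → 0 ≤ t → ∀ x ∈ K, φ (s + t) x = φ s (φ t x))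
    (hLip : ∀ s, 0 ≤ s → ∀ x ∈ K, ∀ y ∈ K, dist (φ s x) (φ s y) ≤ Real.exp (L * s) * dist x y)
    (hcons : ∀ x ∈ K, dist (Φ ε x) (φ ε x) ≤ C * ε ^ (p + 1)) (x : X) (hx : x ∈ K) (k : ℕ) :
    dist ((Φ ε)^[k] x) (φ (k * ε) x) ≤ C * (k * ε) * Real.exp (L * (k * ε)) * ε ^ p := by
  have hcons' : ∀ x ∈ K, dist (Φ ε x) (φ ε x) ≤ (C * ε ^ p) * ε := by
    intro y hy
    have h := hcons y hy
    calc dist (Φ ε y) (φ ε y) ≤ C * ε ^ (p + 1) := h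
      _ = C * ε ^ p * ε := by ring
  have h := oneStep_dist_iterate_le hL hε hφK hΦK hφ0 hφadd hLip hcons' x hx k
  calc dist ((Φ ε)^[k] x) (φ (k * ε) x) ≤ k * (C * ε ^ p * ε) * Real.exp (L * (k * ε)) := h
    _ = C * (k * ε) * Real.exp (L * (k * ε)) * ε ^ p := by ring

end Global

/-! ## §3 Uniform consistency gives uniform convergence -/

section Convergence

variable {X : Type*} [PseudoMetricSpace X]

/-- **Convergence of a uniformly consistent one-step method, uniformly on the invariant set.**  With the
stability hypotheses of `oneStep_dist_iterate_le` for every step size `ε ≥ 0`, assume UNIFORM consistency on `K`: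
for every `η > 0` and all sufficiently small `ε > 0`, `dist (Φ ε x) (φ ε x) ≤ η ε` for every `x ∈ K`.  Then
for every `t > 0` the `m`-step approximation with step `t/m` converges to the exact flow at time `t`,
uniformly in `x ∈ K`. -/
theorem oneStep_tendstoUniformlyOn_iterate {K : Set X} {φ Φ : ℝ → X → X} {L : ℝ} (hL : 0 ≤ L)
    (hφK : ∀ s, 0 ≤ s → MapsTo (φ s) K K) (hΦK : ∀ ε, 0 ≤ ε → MapsTo (Φ ε) K K)
    (hφ0 : ∀ x ∈ K, φ 0 x = x) (hφadd : ∀ s t, 0 ≤ s → 0 ≤ t → ∀ x ∈ K, φ (s + t) x = φ s (φ t x))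
    (hLip : ∀ s, 0 ≤ s → ∀ x ∈ K, ∀ y ∈ K, dist (φ s x) (φ s y) ≤ Real.exp (L * s) * dist x y)
    (hcons : ∀ η, 0 < η → ∀ᶠ ε in 𝓝[>] (0 : ℝ), ∀ x ∈ K, dist (Φ ε x) (φ ε x) ≤ η * ε)
    {t : ℝ} (ht : 0 < t) :
    TendstoUniformlyOn (fun m : ℕ => (Φ (t / m))^[m]) (φ t) atTop K := by
  rw [Metric.tendstoUniformlyOn_iff]
  intro δ hδ
  -- choose the consistency level
  set C : ℝ := t * Real.exp (L * t) with hC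
  have hCpos : 0 < C := mul_pos ht (Real.exp_pos _)
  set η : ℝ := δ / (2 * C) with hη
  have hηpos : 0 < η := div_pos hδ (by positivity)
  -- `t/m → 0⁺` as `m → ∞`
  have htm : Tendsto (fun m : ℕ => t / m) atTop (𝓝[>] (0 : ℝ)) := by
    rw [tendsto_nhdsWithin_iff]
    refine ⟨tendsto_const_div_atTop_nhds_zero_nat t, ?_⟩
    filter_upwards [eventually_gt_atTop 0] with m hm
    exact div_pos ht (Nat.cast_pos.mpr hm)
  have hev := htm.eventually (hcons η hηpos)
  filter_upwards [hev, eventually_gt_atTop 0] with m hm hm0 x hx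
  have hmpos : (0 : ℝ) < m := Nat.cast_pos.mpr hm0
  have hεnn : 0 ≤ t / m := le_of_lt (div_pos ht hmpos)
  have hbound := oneStep_dist_iterate_le hL hεnn hφK (hΦK _ hεnn) hφ0 hφadd hLip hm x hx m
  have hmt : (m : ℝ) * (t / m) = t := mul_div_cancel₀ t (ne_of_gt hmpos)
  rw [hmt] at hbound
  rw [dist_comm]
  calc dist ((Φ (t / m))^[m] x) (φ t x) ≤ m * (η * (t / m)) * Real.exp (L * t) := hbound
    _ = η * C := by rw [hC]; field_simp
    _ = δ / 2 := by rw [hη]; field_simp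
    _ < δ := half_lt_self hδ

/-- Pointwise form: under the hypotheses of `oneStep_tendstoUniformlyOn_iterate`, at every `x ∈ K` and every
`t > 0`, `(Φ (t/m))^[m] x → φ t x` as `m → ∞`. -/
theorem oneStep_tendsto_iterate {K : Set X} {φ Φ : ℝ → X → X} {L : ℝ} (hL : 0 ≤ L)
    (hφK : ∀ s, 0 ≤ s → MapsTo (φ s) K K) (hΦK : ∀ ε, 0 ≤ ε → MapsTo (Φ ε) K K)
    (hφ0 : ∀ x ∈ K, φ 0 x = x) (hφadd : ∀ s t, 0 ≤ s → 0 ≤ t → ∀ x ∈ K, φ (s + t) x = φ s (φ t x))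
    (hLip : ∀ s, 0 ≤ s → ∀ x ∈ K, ∀ y ∈ K, dist (φ s x) (φ s y) ≤ Real.exp (L * s) * dist x y)
    (hcons : ∀ η, 0 < η → ∀ᶠ ε in 𝓝[>] (0 : ℝ), ∀ x ∈ K, dist (Φ ε x) (φ ε x) ≤ η * ε)
    {t : ℝ} (ht : 0 < t) {x : X} (hx : x ∈ K) :
    Tendsto (fun m : ℕ => (Φ (t / m))^[m] x) atTop (𝓝 (φ t x)) :=
  (oneStep_tendstoUniformlyOn_iterate hL hφK hΦK hφ0 hφadd hLip hcons ht).tendsto_at hx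

end Convergence

end Summit.Ventures.LatticeQCDFlow.Scoring
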